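import Summits.QuantumFields.BalabanUV.Beta.FP.KernelPeriodisationFibTraceRel

/-!
# `BalabanUV.Beta.FP.KernelPeriodisationFibTraceTwo` — road «FP» (binder row D1), RULING R-FP-51 row **(T-PER)**, PART 4″ = (P2″) of the OWNER d1-p3 g21's
# WANTED W-FP-21-5 (a) (journal [D1P3-G21-W5]; OFFER O-d1leaf06-g22-1 ACCEPTED W-FP-21-7; gan24-p3 g40 «NOT MINE — GO»): **TWO-INSERTION TORUS TRACES →
# LATTICE TRACES** — for a bi-localised ℤ^{d+1} word `X` (e.g. `A ⋆ U ⋆ A`) and a bi-localised second insertion `V`, the torus trace of the periodised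
# word `X ⋆ dper V` is the DOUBLE period sum `Σ'_j Σ'_m trSh M (X ⋆ V_j) m` of the shifted diagonal traces of the one-copy words `X ⋆ V_j`
# (`V_j = shiftK (M∘j) V`); the companion `KernelPeriodisationFibTraceTwoBound` turns it into `|trace − tr (X ⋆ V)| = O(e^{−(ε∕4)N})`, `ε = min δ δ′`,
# for periods `M_i ≥ N`, and serves the (T-ID) assembly's bubble ∕ tadpole words

WHY NOT PART 4 VERBATIM.  PART 4 (`KernelPeriodisationFibTrace.trace_perF_dper`) reads ONE diagonally periodised bi-localised insertion; the word
`X ⋆ dper M V` is `Mℤ^{d+1}`-invariant on the right but NOT bi-localised (it carries every copy of `V`).  Here the second insertion's period sum is unfolded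
FIRST (`KernelPeriodisationFibLoc.comp_dper_apply_eq_tsum`: `X ⋆ dper V = Σ'_j X ⋆ V_j` entrywise), each one-copy word `Z_j := X ⋆ V_j` IS bi-localised
(`KernelPeriodisationFibTraceRel.biLoc_comp_shiftK`, constant exponentially small in `|q − p′ + M∘j|₁`), PART 4 applies to each `Z_j`, and the copies are
re-summed under ONE dominated triple family (Fubini over `(j, k, m)` at every box point).

WHAT.  §1 the one-copy words: `biLoc_copy` (rate `ε∕2` form, `j`-constant displayed), `summable_copyConst`, the lattice × lattice total of a bi-localised kernel
at a box point `≤ C₀·K(γ)²` (`tsum_abs_lattice_lattice_le`), and the summable TRIPLE family `(j, (k, m)) ↦ Z_j (r + M∘k) (r + M∘k + M∘m) a a`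
(`summable_copies_lattice_lattice`).  §2 **`perZ_dper_comp_dper_eq_tsum`** (`perZ M (dper M (X ⋆ dper V)) r r a a = Σ'_j perZ M (dper M Z_j) r r a a`) and
**`trace_perF_dper_comp_dper`**: `trace (perF M (dper M (X ⋆ dper M V))) = Σ'_j Σ'_m trSh M Z_j m`.  The bounds (`|trace (…) − tr (X ⋆ V)| ≤ C″·e^{−(ε∕4)N}`,
its `Tendsto` corollary) and the bubble ∕ tadpole words of the (T-ID) assembly (`A ⋆ dper U ⋆ A ⋆ dper V` with an `Mℤ`-invariant decaying leg `A`, the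
instance `X := A ⋆ U ⋆ A` after PART 3's `comp_dper_left ∕ comp_dper_right` and PART A's `perF_comp`) follow in the companion `KernelPeriodisationFibTraceTwoBound`.
NOT IN PRINT; OUR BOOKKEEPING ([folklore] Fubini ∕ dominated sums over PARTs 1–4 + `…TraceRel` BY NAME).  No `def`, no `Prop` minted, nothing cited, 0 sorry.
Moves NO (CONV-C) clause and NO row-D1 binder; NOT SDF, NOT D1, NOT BetaPertH, NOT continuum, NOT Clay.
HONEST DEPENDENCY: continuum YM on T⁴ ⇐ BetaPertH ∧ nine spine estimates (0/9 proved); BetaPertH ⇐ (D1) ∧ (D4) ∧ CAP+tail; G-an2-4 gates asym, D1 and NE2/3/4.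
D1 formalisation swarm LEAF PROVER 06 (b2b-balaban-beta-d1-formalise-leaf-06 gen 22), 2026-08-22, on the OWNER's located ask; author lineage of PARTs 1–4 =
road-P3 `b2b-balaban-gan24-p3` (first refusal waived, l.45377).  No existing file touched.
-/

noncomputable section

open scoped BigOperators Matrix
open Finset Filter

namespace Summit.QuantumFields.BalabanUV.Beta.FP.KernelPeriodisationFibTraceTwo

open Literature.MathematicalPhysics.QuantumFieldTheory.Balaban1983to89
open Literature.MathematicalPhysics.QuantumFieldTheory.Balaban1983to89.Beta
open B12Sec2to5 (l1 l1_nonneg)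
open B4TorusKernel.MultiPeriod (translate translate_apply translate_injective)
open B4Sect5Proof (latticeConst latticeConst_nonneg)
open B6Lemma24Torus (pbox)
open ExpKernelCalculus (MKer Decays BiLoc tr shiftK l1_sub_triangle l1_sub_symm summable_exp_shift' tsum_exp_shift' Zl Zl_nonneg abs_tr_le biLoc_comp_biLoc)
open OneStepResolventKernel (biLoc_mono)
open Summit.QuantumFields.BalabanUV.Beta.FP.KernelPeriodisationFib (perZ perZ_apply perF perF_apply Idx translate_eq_add)
open Summit.QuantumFields.BalabanUV.Beta.FP.KernelPeriodisationFibLoc (dper dper_apply summable_exp_l1_translate decays_of_biLoc comp_dper_apply_eq_tsum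
  shiftK_eq_translate)
open Summit.QuantumFields.BalabanUV.Beta.FP.KernelPeriodisationFibTrace (trSh trSh_apply trSh_zero trace_perF trace_perF_dper summable_trSh trSh_eq_sum_tsum
  abs_diag_translate_le summable_diag_translate summable_uncurry_lattice_lattice summable_uncurry_sites_lattice abs_trace_perF_dper_sub_tr_le translate_comm)
open Summit.QuantumFields.BalabanUV.Beta.FP.KernelPeriodisationFibTraceRel (biLoc_comp_shiftK sub_sub_Mmul shiftK_Mmul_zero le_l1_translate_of_ne_zero
  biLoc_min_left biLoc_min_right)
open Summit.QuantumFields.BalabanUV.Beta.GAN24.DirichletExhaustionDeperiodise (translate_zero)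

variable {d : ℕ} {F : Type*} [Fintype F]

/-! ## §1 The one-copy words `Z_j = X ⋆ V_j` and their dominated families -/

section Copies

variable (M : Fin (d + 1) → ℕ) [∀ μ, NeZero (M μ)]
variable {X V : MKer (d + 1) F} {C C' δ δ' : ℝ} {p q p' q' : Fin (d + 1) → ℤ}

omit [∀ μ, NeZero (M μ)] in
/-- [folklore] the `j`-constant of the one-copy word is non-negative. -/
theorem copyConst_nonneg (hC : 0 ≤ C) (hC' : 0 ≤ C') (hδ : 0 < δ) (hδ' : 0 < δ') (j : Fin (d + 1) → ℤ) :
    0 ≤ (Fintype.card F : ℝ) * (C * C') * Zl (d + 1) (min δ δ' / 2) * Real.exp (-(min δ δ' / 2) * l1 (translate M (q - p') j)) :=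
  mul_nonneg (mul_nonneg (mul_nonneg (Nat.cast_nonneg _) (mul_nonneg hC hC')) (Zl_nonneg (half_pos (lt_min hδ hδ')))) (Real.exp_pos _).le

omit [∀ μ, NeZero (M μ)] in
/-- [folklore] **THE ONE-COPY WORD IS BI-LOCALISED, `j`-DEPENDENCE DISPLAYED, RATE HALVED**: `Z_j := X ⋆ shiftK (M∘j) V` is bi-localised at
`(p, q′ − M∘j)` with constant `B·e^{−(ε∕2)|(q−p′) + M∘j|₁}`, `B = |F|·C·C′·Zl(ε∕2)`, at rate `ε∕2` (`ε = min δ δ′`; `biLoc_comp_shiftK` + `biLoc_mono`). -/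
theorem biLoc_copy (hX : BiLoc X p q C δ) (hV : BiLoc V p' q' C' δ') (hC : 0 ≤ C) (hC' : 0 ≤ C') (hδ : 0 < δ) (hδ' : 0 < δ')
    (j : Fin (d + 1) → ℤ) :
    BiLoc (ExpKernelCalculus.comp X (shiftK (fun i => (M i : ℤ) * j i) V)) p (q' - fun i => (M i : ℤ) * j i)
      ((Fintype.card F : ℝ) * (C * C') * Zl (d + 1) (min δ δ' / 2) * Real.exp (-(min δ δ' / 2) * l1 (translate M (q - p') j)))
      (min δ δ' / 2) := by
  have h := biLoc_comp_shiftK hX hV hC hC' hδ hδ' (fun i => (M i : ℤ) * j i)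
  rw [sub_sub_Mmul M q p' j] at h
  exact biLoc_mono h (copyConst_nonneg M hC hC' hδ hδ' j) (half_le_self (lt_min hδ hδ').le)

/-- [folklore] the `j`-constants are summable over the period lattice: `Σ'_j e^{−(ε∕2)|(q−p′)+M∘j|₁} ≤ K_{d+1}(ε∕2)`. -/
theorem summable_copyConst {ε : ℝ} (hε : 0 < ε) (w : Fin (d + 1) → ℤ) :
    Summable (fun j : Fin (d + 1) → ℤ => Real.exp (-ε * l1 (translate M w j))) ∧
      ∑' j : Fin (d + 1) → ℤ, Real.exp (-ε * l1 (translate M w j)) ≤ latticeConst (d + 1) ε := by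
  obtain ⟨hs, hle⟩ := summable_exp_l1_translate M hε 0 w
  simp only [sub_zero] at hs hle
  exact ⟨hs, hle⟩

omit [Fintype F] in
/-- [folklore] **THE LATTICE × LATTICE TOTAL OF A BI-LOCALISED KERNEL AT A BOX POINT**: for `BiLoc Y p₀ q₀ C₀ γ`, `γ > 0`,
`Σ'_{(k,m)} |Y (r+M∘k) (r+M∘k+M∘m) a b| ≤ C₀·K_{d+1}(γ)²` (inner sum by `summable_diag_translate`, outer by `summable_exp_l1_translate`). -/
theorem tsum_abs_lattice_lattice_le {Y : MKer (d + 1) F} {p₀ q₀ : Fin (d + 1) → ℤ} {C₀ γ : ℝ} (hY : BiLoc Y p₀ q₀ C₀ γ) (hC₀ : 0 ≤ C₀) (hγ : 0 < γ)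
    (r : Fin (d + 1) → ℤ) (a b : F) :
    ∑' km : (Fin (d + 1) → ℤ) × (Fin (d + 1) → ℤ), |Y (translate M r km.1) (translate M (translate M r km.1) km.2) a b| ≤
      C₀ * latticeConst (d + 1) γ * latticeConst (d + 1) γ := by
  have hsa : Summable fun km : (Fin (d + 1) → ℤ) × (Fin (d + 1) → ℤ) => |Y (translate M r km.1) (translate M (translate M r km.1) km.2) a b| :=
    (summable_uncurry_lattice_lattice M hY hC₀ hγ r a b).abs
  obtain ⟨hk, hkle⟩ := summable_exp_l1_translate M hγ p₀ r
  have hin : ∀ k : Fin (d + 1) → ℤ, ∑' m : Fin (d + 1) → ℤ, |Y (translate M r k) (translate M (translate M r k) m) a b| ≤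
      C₀ * latticeConst (d + 1) γ * Real.exp (-γ * l1 (translate M r k - p₀)) := fun k =>
    (summable_diag_translate M hY hC₀ hγ (translate M r k) a b).2
  calc ∑' km : (Fin (d + 1) → ℤ) × (Fin (d + 1) → ℤ), |Y (translate M r km.1) (translate M (translate M r km.1) km.2) a b|
      = ∑' k : Fin (d + 1) → ℤ, ∑' m : Fin (d + 1) → ℤ, |Y (translate M r k) (translate M (translate M r k) m) a b| := hsa.tsum_prod
    _ ≤ ∑' k, C₀ * latticeConst (d + 1) γ * Real.exp (-γ * l1 (translate M r k - p₀)) := hsa.prod.tsum_le_tsum hin (hk.mul_left _)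
    _ = C₀ * latticeConst (d + 1) γ * ∑' k, Real.exp (-γ * l1 (translate M r k - p₀)) := tsum_mul_left
    _ ≤ C₀ * latticeConst (d + 1) γ * latticeConst (d + 1) γ :=
        mul_le_mul_of_nonneg_left hkle (mul_nonneg hC₀ (latticeConst_nonneg _ hγ.le))

/-- [folklore] **THE TRIPLE FAMILY IS SUMMABLE**: at every box point `r` and fibre component `a`, `(j, (k, m)) ↦ Z_j (r+M∘k) (r+M∘k+M∘m) a a` is summable
(each copy dominated by PART 4's lattice × lattice family with total `≤ Cj·K(ε∕2)²`, and `Σ_j Cj < ∞`). -/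
theorem summable_copies_lattice_lattice (hX : BiLoc X p q C δ) (hV : BiLoc V p' q' C' δ') (hC : 0 ≤ C) (hC' : 0 ≤ C') (hδ : 0 < δ) (hδ' : 0 < δ')
    (r : Fin (d + 1) → ℤ) (a : F) :
    Summable fun t : (Fin (d + 1) → ℤ) × ((Fin (d + 1) → ℤ) × (Fin (d + 1) → ℤ)) =>
      ExpKernelCalculus.comp X (shiftK (fun i => (M i : ℤ) * t.1 i) V) (translate M r t.2.1) (translate M (translate M r t.2.1) t.2.2) a a := by
  have hε : 0 < min δ δ' / 2 := half_pos (lt_min hδ hδ')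
  set B := (Fintype.card F : ℝ) * (C * C') * Zl (d + 1) (min δ δ' / 2) with hB
  -- the non-negative majorant `|Z_j (r+Mk) (r+Mk+Mm) a a|` is summable, by `summable_prod_of_nonneg`
  have hg : Summable fun t : (Fin (d + 1) → ℤ) × ((Fin (d + 1) → ℤ) × (Fin (d + 1) → ℤ)) =>
      |ExpKernelCalculus.comp X (shiftK (fun i => (M i : ℤ) * t.1 i) V) (translate M r t.2.1) (translate M (translate M r t.2.1) t.2.2) a a| := by
    refine (summable_prod_of_nonneg fun t => abs_nonneg _).2 ⟨fun j => ?_, ?_⟩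
    · exact (summable_uncurry_lattice_lattice M (biLoc_copy M hX hV hC hC' hδ hδ' j) (copyConst_nonneg M hC hC' hδ hδ' j) hε r a a).abs
    · have hmaj := ((summable_copyConst M hε (q - p')).1).mul_left (B * latticeConst (d + 1) (min δ δ' / 2) * latticeConst (d + 1) (min δ δ' / 2))
      refine hmaj.of_nonneg_of_le (fun j => tsum_nonneg fun _ => abs_nonneg _) fun j => ?_
      refine (tsum_abs_lattice_lattice_le M (biLoc_copy M hX hV hC hC' hδ hδ' j) (copyConst_nonneg M hC hC' hδ hδ' j) hε r a a).trans (le_of_eq ?_)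
      rw [hB]; ring
  refine hg.of_norm_bounded fun t => ?_
  rw [Real.norm_eq_abs]

end Copies

/-! ## §2 The torus trace of the two-insertion word -/

section Main

variable (M : Fin (d + 1) → ℕ) [∀ μ, NeZero (M μ)]
variable {X V : MKer (d + 1) F} {C C' δ δ' : ℝ} {p q p' q' : Fin (d + 1) → ℤ}

/-- [folklore] per copy, the periodised entry at a box point as ONE sum over `lattice × lattice`:
`perZ M (dper M Z_j) r r a a = Σ'_{(k,m)} Z_j (r+M∘k) (r+M∘k+M∘m) a a`. -/
theorem perZ_dper_copy_eq_tsum_prod (hX : BiLoc X p q C δ) (hV : BiLoc V p' q' C' δ') (hC : 0 ≤ C) (hC' : 0 ≤ C') (hδ : 0 < δ) (hδ' : 0 < δ')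
    (r : Fin (d + 1) → ℤ) (a : F) (j : Fin (d + 1) → ℤ) :
    perZ M (dper M (ExpKernelCalculus.comp X (shiftK (fun i => (M i : ℤ) * j i) V))) r r a a =
      ∑' km : (Fin (d + 1) → ℤ) × (Fin (d + 1) → ℤ),
        ExpKernelCalculus.comp X (shiftK (fun i => (M i : ℤ) * j i) V) (translate M r km.1) (translate M (translate M r km.1) km.2) a a := by
  have hε : 0 < min δ δ' / 2 := half_pos (lt_min hδ hδ')
  have hj := summable_uncurry_lattice_lattice M (biLoc_copy M hX hV hC hC' hδ hδ' j) (copyConst_nonneg M hC hC' hδ hδ' j) hε r a a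
  simp only [perZ_apply, dper_apply]
  -- the `dper` copy index inside, the `perZ` wrap index outside: commute the two translates, then `Σ'_m Σ'_k = Σ'_k Σ'_m = Σ'_{(k,m)}`
  have e : (fun m : Fin (d + 1) → ℤ => ∑' k : Fin (d + 1) → ℤ,
        ExpKernelCalculus.comp X (shiftK (fun i => (M i : ℤ) * j i) V) (translate M r k) (translate M (translate M r m) k) a a)
      = fun m => ∑' k : Fin (d + 1) → ℤ,
        ExpKernelCalculus.comp X (shiftK (fun i => (M i : ℤ) * j i) V) (translate M r k) (translate M (translate M r k) m) a a :=
    funext fun m => tsum_congr fun k => by rw [translate_comm M r m k]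
  rw [e, hj.tsum_comm]
  exact hj.tsum_prod.symm

/-- [folklore] **THE PERIODISED ENTRY OF THE TWO-INSERTION WORD IS THE SUM OVER THE COPIES**: at a box point,
`perZ M (dper M (X ⋆ dper M V)) r r a a = Σ'_j perZ M (dper M (X ⋆ V_j)) r r a a` (Fubini over the triple family of §1). -/
theorem perZ_dper_comp_dper_eq_tsum (hX : BiLoc X p q C δ) (hV : BiLoc V p' q' C' δ') (hC : 0 ≤ C) (hC' : 0 ≤ C') (hδ : 0 < δ) (hδ' : 0 < δ')
    (r : Fin (d + 1) → ℤ) (a : F) :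
    perZ M (dper M (ExpKernelCalculus.comp X (dper M V))) r r a a =
      ∑' j : Fin (d + 1) → ℤ, perZ M (dper M (ExpKernelCalculus.comp X (shiftK (fun i => (M i : ℤ) * j i) V))) r r a a := by
  have h3 := summable_copies_lattice_lattice M hX hV hC hC' hδ hδ' r a
  have h3' : Summable (Function.uncurry fun (j : Fin (d + 1) → ℤ) (km : (Fin (d + 1) → ℤ) × (Fin (d + 1) → ℤ)) =>
      ExpKernelCalculus.comp X (shiftK (fun i => (M i : ℤ) * j i) V) (translate M r km.1) (translate M (translate M r km.1) km.2) a a) := h3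
  -- the `(k, m)`-family of copy sums and its curried form
  have hg : Summable fun km : (Fin (d + 1) → ℤ) × (Fin (d + 1) → ℤ) => ∑' j : Fin (d + 1) → ℤ,
      ExpKernelCalculus.comp X (shiftK (fun i => (M i : ℤ) * j i) V) (translate M r km.1) (translate M (translate M r km.1) km.2) a a :=
    h3.prod_symm.prod
  have hg' : Summable (Function.uncurry fun (k m : Fin (d + 1) → ℤ) => ∑' j : Fin (d + 1) → ℤ,
      ExpKernelCalculus.comp X (shiftK (fun i => (M i : ℤ) * j i) V) (translate M r k) (translate M (translate M r k) m) a a) := hg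
  -- unfold the left side: commute the two translates and expand the entry over the copies
  have lhs : perZ M (dper M (ExpKernelCalculus.comp X (dper M V))) r r a a =
      ∑' m : Fin (d + 1) → ℤ, ∑' k : Fin (d + 1) → ℤ, ∑' j : Fin (d + 1) → ℤ,
        ExpKernelCalculus.comp X (shiftK (fun i => (M i : ℤ) * j i) V) (translate M r k) (translate M (translate M r k) m) a a := by
    simp only [perZ_apply, dper_apply]
    refine tsum_congr fun m => tsum_congr fun k => ?_
    rw [translate_comm M r m k]
    exact comp_dper_apply_eq_tsum M (decays_of_biLoc hX hC hδ.le) hδ hV hδ' _ _ a a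
  rw [lhs, hg'.tsum_comm, ← hg.tsum_prod, h3'.tsum_comm]
  exact tsum_congr fun j => (perZ_dper_copy_eq_tsum_prod M hX hV hC hC' hδ hδ' r a j).symm

/-- [folklore] the copies' periodised entries are summable over `j` (for exchanging with the finite trace sums). -/
theorem summable_perZ_dper_copies (hX : BiLoc X p q C δ) (hV : BiLoc V p' q' C' δ') (hC : 0 ≤ C) (hC' : 0 ≤ C') (hδ : 0 < δ) (hδ' : 0 < δ')
    (r : Fin (d + 1) → ℤ) (a : F) :
    Summable fun j : Fin (d + 1) → ℤ => perZ M (dper M (ExpKernelCalculus.comp X (shiftK (fun i => (M i : ℤ) * j i) V))) r r a a := by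
  have h3 := summable_copies_lattice_lattice M hX hV hC hC' hδ hδ' r a
  have h : (fun j : Fin (d + 1) → ℤ => perZ M (dper M (ExpKernelCalculus.comp X (shiftK (fun i => (M i : ℤ) * j i) V))) r r a a)
      = fun j => ∑' km : (Fin (d + 1) → ℤ) × (Fin (d + 1) → ℤ),
          ExpKernelCalculus.comp X (shiftK (fun i => (M i : ℤ) * j i) V) (translate M r km.1) (translate M (translate M r km.1) km.2) a a :=
    funext fun j => perZ_dper_copy_eq_tsum_prod M hX hV hC hC' hδ hδ' r a j
  rw [h]
  exact h3.prod

/-- [folklore] **`trace_perF_dper_comp_dper` — THE TWO-INSERTION TORUS-TRACE IDENTITY**: for bi-localised `X` (`BiLoc X p q C δ`) and `V`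
(`BiLoc V p′ q′ C′ δ′`), `trace (perF M (dper M (X ⋆ dper M V))) = Σ'_j Σ'_m trSh M (X ⋆ shiftK (M∘j) V) m` — the `(j, m) = (0, 0)` term is the
lattice trace `tr (X ⋆ V)`; `j` indexes the copies of the second insertion, `m` the diagonal wrap of PART 4. -/
theorem trace_perF_dper_comp_dper (hX : BiLoc X p q C δ) (hV : BiLoc V p' q' C' δ') (hδ : 0 < δ) (hδ' : 0 < δ') :
    Matrix.trace (perF M (dper M (ExpKernelCalculus.comp X (dper M V)))) =
      ∑' j : Fin (d + 1) → ℤ, ∑' m : Fin (d + 1) → ℤ, trSh M (ExpKernelCalculus.comp X (shiftK (fun i => (M i : ℤ) * j i) V)) m := by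
  rcases isEmpty_or_nonempty F with hF | ⟨⟨a₀⟩⟩
  · rw [trace_perF]
    simp [Finset.univ_eq_empty, trSh_apply, tsum_zero]
  have hC : 0 ≤ C := hX.nonneg a₀
  have hC' : 0 ≤ C' := hV.nonneg a₀
  have hε : 0 < min δ δ' / 2 := half_pos (lt_min hδ hδ')
  have hP : ∀ (r : Fin (d + 1) → ℤ) (a : F), Summable fun j : Fin (d + 1) → ℤ =>
      perZ M (dper M (ExpKernelCalculus.comp X (shiftK (fun i => (M i : ℤ) * j i) V))) r r a a := fun r a =>
    summable_perZ_dper_copies M hX hV hC hC' hδ hδ' r a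
  -- per copy: PART 4's identity
  have key : ∀ j : Fin (d + 1) → ℤ, Matrix.trace (perF M (dper M (ExpKernelCalculus.comp X (shiftK (fun i => (M i : ℤ) * j i) V)))) =
      ∑' m : Fin (d + 1) → ℤ, trSh M (ExpKernelCalculus.comp X (shiftK (fun i => (M i : ℤ) * j i) V)) m := fun j =>
    trace_perF_dper M (biLoc_copy M hX hV hC hC' hδ hδ' j) hε
  calc Matrix.trace (perF M (dper M (ExpKernelCalculus.comp X (dper M V))))
      = ∑ r : ↥(pbox M), ∑ a : F, ∑' j : Fin (d + 1) → ℤ,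
          perZ M (dper M (ExpKernelCalculus.comp X (shiftK (fun i => (M i : ℤ) * j i) V))) (r : Fin (d + 1) → ℤ) (r : Fin (d + 1) → ℤ) a a := by
        rw [trace_perF]
        exact Finset.sum_congr rfl fun r _ => Finset.sum_congr rfl fun a _ =>
          perZ_dper_comp_dper_eq_tsum M hX hV hC hC' hδ hδ' (r : Fin (d + 1) → ℤ) a
    _ = ∑ r : ↥(pbox M), ∑' j : Fin (d + 1) → ℤ, ∑ a : F,
          perZ M (dper M (ExpKernelCalculus.comp X (shiftK (fun i => (M i : ℤ) * j i) V))) (r : Fin (d + 1) → ℤ) (r : Fin (d + 1) → ℤ) a a :=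
        Finset.sum_congr rfl fun r _ => (Summable.tsum_finsetSum fun a _ => hP (r : Fin (d + 1) → ℤ) a).symm
    _ = ∑' j : Fin (d + 1) → ℤ, ∑ r : ↥(pbox M), ∑ a : F,
          perZ M (dper M (ExpKernelCalculus.comp X (shiftK (fun i => (M i : ℤ) * j i) V))) (r : Fin (d + 1) → ℤ) (r : Fin (d + 1) → ℤ) a a :=
        (Summable.tsum_finsetSum (s := (Finset.univ : Finset ↥(pbox M)))
          (f := fun (r : ↥(pbox M)) (j : Fin (d + 1) → ℤ) => ∑ a : F,
            perZ M (dper M (ExpKernelCalculus.comp X (shiftK (fun i => (M i : ℤ) * j i) V))) (r : Fin (d + 1) → ℤ) (r : Fin (d + 1) → ℤ) a a)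
          fun r _ => summable_sum fun a _ => hP (r : Fin (d + 1) → ℤ) a).symm
    _ = ∑' j : Fin (d + 1) → ℤ, Matrix.trace (perF M (dper M (ExpKernelCalculus.comp X (shiftK (fun i => (M i : ℤ) * j i) V)))) := by
        refine tsum_congr fun j => ?_
        rw [trace_perF]
    _ = _ := tsum_congr key

end Main

/-! ## §3 Letters for the estimate: every copy's diagonal traces in total, the `j ≠ 0` tail termwise, the `j = 0` copy's data -/

section Bounds

variable (M : Fin (d + 1) → ℕ) [∀ μ, NeZero (M μ)]
variable {X V : MKer (d + 1) F} {C C' δ δ' : ℝ} {p q p' q' : Fin (d + 1) → ℤ}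

/-- [folklore] **ALL SHIFTED DIAGONAL TRACES OF A BI-LOCALISED KERNEL, IN TOTAL**: for `BiLoc Y p₀ q₀ C₀ γ`, `γ > 0`,
`|Σ'_m trSh M Y m| ≤ |F|·C₀·Zl(γ∕2)·K_{d+1}(γ∕2)` (PART 4's dominating pair family `summable_expPair`, half the rate spent on summability). -/
theorem abs_tsum_trSh_le {Y : MKer (d + 1) F} {p₀ q₀ : Fin (d + 1) → ℤ} {C₀ γ : ℝ} (hY : BiLoc Y p₀ q₀ C₀ γ) (hC₀ : 0 ≤ C₀) (hγ : 0 < γ) :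
    |∑' m : Fin (d + 1) → ℤ, trSh M Y m| ≤ (Fintype.card F : ℝ) * C₀ * (Zl (d + 1) (γ / 2) * latticeConst (d + 1) (γ / 2)) := by
  have hY' : BiLoc Y p₀ q₀ C₀ (γ / 2) := biLoc_mono hY hC₀ (half_le_self hγ.le)
  obtain ⟨hpair, hle⟩ := KernelPeriodisationFibTrace.summable_expPair M hγ p₀ q₀
  -- termwise: `|trSh M Y m| ≤ |F|·C₀·Σ'_x e^{−(γ/2)|x−p₀|}·e^{−(γ/2)|x+M∘m−q₀|}`
  have hterm : ∀ m : Fin (d + 1) → ℤ, |trSh M Y m| ≤ (Fintype.card F : ℝ) * C₀ *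
      ∑' x : Fin (d + 1) → ℤ, Real.exp (-(γ / 2) * l1 (x - p₀)) * Real.exp (-(γ / 2) * l1 (translate M x m - q₀)) := fun m => by
    rw [trSh_apply]
    have hin := hpair.prod_symm.prod_factor m
    have hmaj := hin.mul_left ((Fintype.card F : ℝ) * C₀)
    have hb := tsum_of_norm_bounded hmaj.hasSum fun x => by
      rw [Real.norm_eq_abs]
      calc |∑ a, Y x (translate M x m) a a| ≤ ∑ a, |Y x (translate M x m) a a| := Finset.abs_sum_le_sum_abs _ _
        _ ≤ ∑ _a : F, C₀ * Real.exp (-(γ / 2) * l1 (x - p₀)) * Real.exp (-(γ / 2) * l1 (translate M x m - q₀)) :=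
            Finset.sum_le_sum fun a _ => abs_diag_translate_le M hY' x m a a
        _ = (Fintype.card F : ℝ) * C₀ * (Real.exp (-(γ / 2) * l1 (x - p₀)) * Real.exp (-(γ / 2) * l1 (translate M x m - q₀))) := by
            rw [Finset.sum_const, Finset.card_univ, nsmul_eq_mul]; ring
    rw [Real.norm_eq_abs] at hb
    refine hb.trans (le_of_eq ?_)
    exact tsum_mul_left
  have hg : Summable fun m : Fin (d + 1) → ℤ => (Fintype.card F : ℝ) * C₀ *
      ∑' x : Fin (d + 1) → ℤ, Real.exp (-(γ / 2) * l1 (x - p₀)) * Real.exp (-(γ / 2) * l1 (translate M x m - q₀)) :=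
    hpair.prod_symm.prod.mul_left _
  have hb := tsum_of_norm_bounded hg.hasSum fun m => by rw [Real.norm_eq_abs]; exact hterm m
  rw [Real.norm_eq_abs] at hb
  refine hb.trans ?_
  have hpairU : Summable (Function.uncurry fun (x m : Fin (d + 1) → ℤ) =>
      Real.exp (-(γ / 2) * l1 (x - p₀)) * Real.exp (-(γ / 2) * l1 (translate M x m - q₀))) := hpair
  rw [tsum_mul_left]
  refine mul_le_mul_of_nonneg_left ?_ (by positivity)
  rw [hpairU.tsum_comm, ← hpair.tsum_prod]
  exact hle

/-- [folklore] **THE `j`-FAMILY OF COPY TRACES IS SUMMABLE** (`|Σ'_m trSh M Z_j m| ≤ |F|·Cj·Zl(ε∕4)·K(ε∕4)`, `Σ_j Cj < ∞`). -/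
theorem summable_tsum_trSh_copies (hX : BiLoc X p q C δ) (hV : BiLoc V p' q' C' δ') (hC : 0 ≤ C) (hC' : 0 ≤ C') (hδ : 0 < δ) (hδ' : 0 < δ') :
    Summable fun j : Fin (d + 1) → ℤ => ∑' m : Fin (d + 1) → ℤ, trSh M (ExpKernelCalculus.comp X (shiftK (fun i => (M i : ℤ) * j i) V)) m := by
  have hε : 0 < min δ δ' / 2 := half_pos (lt_min hδ hδ')
  set B := (Fintype.card F : ℝ) * (C * C') * Zl (d + 1) (min δ δ' / 2) with hB
  have hmaj := ((summable_copyConst M hε (q - p')).1).mul_left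
    ((Fintype.card F : ℝ) * B * (Zl (d + 1) (min δ δ' / 2 / 2) * latticeConst (d + 1) (min δ δ' / 2 / 2)))
  refine hmaj.of_norm_bounded fun j => ?_
  rw [Real.norm_eq_abs]
  refine (abs_tsum_trSh_le M (biLoc_copy M hX hV hC hC' hδ hδ' j) (copyConst_nonneg M hC hC' hδ hδ' j) hε).trans (le_of_eq ?_)
  rw [hB]; ring

/-- [folklore] **THE `j ≠ 0` COPIES ARE THE WRAP-AROUND IN THE SECOND INSERTION**: for periods `M_i ≥ N` and every `j`,
`|ite (j = 0) 0 (Σ'_m trSh M Z_j m)| ≤ |F|·B·Zl(ε∕4)·K(ε∕4)·e^{(ε∕4)|q−p′|₁}·e^{−(ε∕4)N}·e^{−(ε∕4)|(q−p′)+M∘j|₁}` (`B = |F|·C·C′·Zl(ε∕2)`). -/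
theorem abs_ite_tsum_trSh_copy_le (hX : BiLoc X p q C δ) (hV : BiLoc V p' q' C' δ') (hC : 0 ≤ C) (hC' : 0 ≤ C') (hδ : 0 < δ) (hδ' : 0 < δ')
    {N : ℕ} (hMN : ∀ i, N ≤ M i) (j : Fin (d + 1) → ℤ) :
    |(if j = 0 then (0 : ℝ) else ∑' m : Fin (d + 1) → ℤ, trSh M (ExpKernelCalculus.comp X (shiftK (fun i => (M i : ℤ) * j i) V)) m)| ≤
      (Fintype.card F : ℝ) * ((Fintype.card F : ℝ) * (C * C') * Zl (d + 1) (min δ δ' / 2)) *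
        (Zl (d + 1) (min δ δ' / 2 / 2) * latticeConst (d + 1) (min δ δ' / 2 / 2)) *
        Real.exp (min δ δ' / 4 * l1 (q - p')) * Real.exp (-(min δ δ' / 4 * N)) * Real.exp (-(min δ δ' / 4) * l1 (translate M (q - p') j)) := by
  have hε0 : 0 < min δ δ' := lt_min hδ hδ'
  have hε : 0 < min δ δ' / 2 := half_pos hε0
  have hZ2 : 0 ≤ Zl (d + 1) (min δ δ' / 2) := Zl_nonneg hε
  have hZ4 : 0 ≤ Zl (d + 1) (min δ δ' / 2 / 2) := Zl_nonneg (half_pos hε)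
  have hK4 : 0 ≤ latticeConst (d + 1) (min δ δ' / 2 / 2) := latticeConst_nonneg _ (half_pos hε).le
  split_ifs with hj
  · rw [abs_zero]; positivity
  · refine (abs_tsum_trSh_le M (biLoc_copy M hX hV hC hC' hδ hδ' j) (copyConst_nonneg M hC hC' hδ hδ' j) hε).trans ?_
    have hgeo := le_l1_translate_of_ne_zero M hMN (q - p') hj
    have hkey : Real.exp (-(min δ δ' / 2) * l1 (translate M (q - p') j)) ≤
        Real.exp (min δ δ' / 4 * l1 (q - p')) * Real.exp (-(min δ δ' / 4 * N)) * Real.exp (-(min δ δ' / 4) * l1 (translate M (q - p') j)) := by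
      rw [← Real.exp_add, ← Real.exp_add, Real.exp_le_exp]; nlinarith [hε0.le, l1_nonneg (translate M (q - p') j)]
    calc (Fintype.card F : ℝ) * ((Fintype.card F : ℝ) * (C * C') * Zl (d + 1) (min δ δ' / 2) *
            Real.exp (-(min δ δ' / 2) * l1 (translate M (q - p') j))) *
            (Zl (d + 1) (min δ δ' / 2 / 2) * latticeConst (d + 1) (min δ δ' / 2 / 2))
        ≤ (Fintype.card F : ℝ) * ((Fintype.card F : ℝ) * (C * C') * Zl (d + 1) (min δ δ' / 2) *
            (Real.exp (min δ δ' / 4 * l1 (q - p')) * Real.exp (-(min δ δ' / 4 * N)) * Real.exp (-(min δ δ' / 4) * l1 (translate M (q - p') j)))) *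
            (Zl (d + 1) (min δ δ' / 2 / 2) * latticeConst (d + 1) (min δ δ' / 2 / 2)) := by gcongr
      _ = _ := by ring

omit [∀ μ, NeZero (M μ)] in
/-- [folklore] the `j = 0` copy is the lattice word itself: `X ⋆ V` is bi-localised at `(p, q′)` with constant `B·e^{−(ε∕2)|q−p′|₁}` at rate `ε∕2`
(`biLoc_comp_biLoc` at the common rate, halved). -/
theorem biLoc_copy_zero (hX : BiLoc X p q C δ) (hV : BiLoc V p' q' C' δ') (hC : 0 ≤ C) (hC' : 0 ≤ C') (hδ : 0 < δ) (hδ' : 0 < δ') :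
    BiLoc (ExpKernelCalculus.comp X V) p q'
      ((Fintype.card F : ℝ) * (C * C') * Zl (d + 1) (min δ δ' / 2) * Real.exp (-(min δ δ' / 2) * l1 (q - p'))) (min δ δ' / 2) :=
  biLoc_mono (biLoc_comp_biLoc (biLoc_min_left hX hC δ') (biLoc_min_right hV hC' δ) (lt_min hδ hδ'))
    (mul_nonneg (mul_nonneg (mul_nonneg (Nat.cast_nonneg _) (mul_nonneg hC hC')) (Zl_nonneg (half_pos (lt_min hδ hδ')))) (Real.exp_pos _).le)
    (half_le_self (lt_min hδ hδ').le)

end Bounds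

end Summit.QuantumFields.BalabanUV.Beta.FP.KernelPeriodisationFibTraceTwo

end
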